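import Summits.RiemannHypothesis.RiemannHypothesis.Theorems.WeilFormatCFamilyGram
import Summits.RiemannHypothesis.RiemannHypothesis.Theorems.WeilFormatCLogTailSums
import Literature.Analysis.ValidatedNumerics.MultiPrecisionInterval
import HarnessLib

/-!
# Format C, design C∞ (E2c, glue): rescaled (tag, power) families and the Hankel family-Gram majorant

Route context: Fourier–Galerkin / Schur-complement certificates of Weil positivity on a window ("format C", C∞ door
`weilPositivityOn_of_cinf_poly`; cell memo `run/shared/lean/pub/rh-explicit/rh-explicit-weil-2/gen15/E2-PLAN-v2.md`
§3.4/§5.5; supporting stmt-RiemannHypothesis-0098; seat rh-explicit-weil-2).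

The collected rows / images / profile tables of the C∞ door (`abs_evenRow_sub_collected_le`,
`abs_re_image_pow_sub_collected_le`, `evenVTable_family`, …) are family sums over `Fin 4 × Fin (D+1)` with
families `T_t(m)/m^d` (tags `T = (1, log m, −C_m, S_m)`, powers `d ≤ D`; the power `d = 0` carries empty fibers).
The coefficients reach `10^{40…90}` at `a = 1` (E2-PLAN §3.4), so the rung uses the RESCALED families
`φ̃_{(t,e)}(m) = T_t(m)·(m₀/m)^{e+1}` over `Fin 4 × Fin D` with coefficients `P(t,e+1)/m₀^{e+1} = O(1)`.  This file is
the glue, free of definitions and of special values: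

* `cinf_sum_tagPow_rescale` — `Σ_{(t,d) : Fin 4 × Fin (D+1)} P(t,d)·T_t/m^d = Σ_{(t,e) : Fin 4 × Fin D}
  (P(t,e+1)/m₀^{e+1})·(T_t·(m₀/m)^{e+1})` when `P(t,0) = 0`; `cinf_collected_rescale(_eq)` — the same applied to a
  collected inequality / identity (literally the `hrowe/himge/hVe` shapes of the door after rescaling);
* `cinf_summable_rescaled_sq`, `cinf_summable_tag_sq_of_abs_le`, `cinf_summable_log_sq` — square-summability of the
  rescaled families from `Σ T_t(m)²/m² < ∞` (bounded tags; the `log` tag via `WeilFormatCLogTailSums`);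
* `cinf_sum_Ico_sq_le_of_hankel_boxes` — **the family-Gram majorant `hΓe` from HANKEL entry boxes**: boxes
  `|Σ'_k T_t T_{t'} (m₀/(m₀+k))^s − Hmid(t,t',s)| ≤ Hrad(t,t',s)` for `2 ≤ s ≤ 2D` (one box per `(t,t',s)`, not per pair
  of families) give, for every `N` and `u`,
  `Σ_{m∈Ico m₀ N} (Σ_y u_y φ̃_y(m))² ≤ Σ_{y,y'} u_y u_{y'} Hmid(t,t',e+e'+2) + Σ_y u_y² Σ_{y'} Hrad(t,t',e+e'+2) ν_{y'}/ν_y`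
  (`sum_Ico_sq_sum_mul_le_of_boxes` of `WeilFormatCFamilyGram`, transported to the product index);
* `cinf_abs_sub_mid_le_of_mem` — a fixed-point box `MI.mem S x B` as `|x − mid| ≤ rad` with rational `mid, rad`
  (how the kernel boxes of `WeilFormatCCinfGramTails` & co. feed `Hmid/Hrad`); `cinf_pure_hankel_entry_eq` — the
  pure×pure entry `Σ'_k 1·1·(m₀/(m₀+k))^s` in the form `m₀^s·Σ'_k ((k+m₀)^s)⁻¹` enclosed by `CinfCoeff.mem_pureTailScaledBox`.

Elementary; standard axioms; no definitions; no RH claim.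
-/

set_option autoImplicit false
-- `Summit.RiemannHypothesis.RiemannHypothesis.…` is the layout-mandated namespace (summit = problem name).
set_option linter.dupNamespace false

namespace Summit.RiemannHypothesis.RiemannHypothesis.Theorems.WeilFormatC

open Finset

/-! ## Rescaling the (tag, power) families -/

/-- One term: `P·(T/m^n) = (P/m₀^n)·(T·(m₀/m)^n)` for `m₀ ≠ 0` (both sides vanish at `m = 0 < n`). -/
theorem cinf_term_rescale (P T m : ℝ) {m₀ : ℝ} (hm₀ : m₀ ≠ 0) (n : ℕ) :
    P * (T / m ^ n) = P / m₀ ^ n * (T * (m₀ / m) ^ n) := by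
  have h : m₀ ^ n ≠ 0 := pow_ne_zero n hm₀
  rw [div_pow, eq_comm]
  calc P / m₀ ^ n * (T * (m₀ ^ n / m ^ n)) = m₀ ^ n / m₀ ^ n * (P * (T / m ^ n)) := by ring
    _ = P * (T / m ^ n) := by rw [div_self h, one_mul]

/-- **Dropping the empty power and rescaling**: if `P(t,0) = 0` for every tag, then
`Σ_{x : Fin 4 × Fin (D+1)} P(x.1,x.2)·(T_{x.1}/m^{x.2}) = Σ_{y : Fin 4 × Fin D} (P(y.1,y.2+1)/m₀^{y.2+1})·(T_{y.1}·(m₀/m)^{y.2+1})`. -/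
theorem cinf_sum_tagPow_rescale (P : Fin 4 → ℕ → ℝ) (hP0 : ∀ t, P t 0 = 0) (T : Fin 4 → ℝ) (m : ℝ)
    {m₀ : ℝ} (hm₀ : m₀ ≠ 0) (D : ℕ) :
    ∑ x : Fin 4 × Fin (D + 1), P x.1 x.2 * (T x.1 / m ^ (x.2 : ℕ))
      = ∑ y : Fin 4 × Fin D, P y.1 ((y.2 : ℕ) + 1) / m₀ ^ ((y.2 : ℕ) + 1) * (T y.1 * (m₀ / m) ^ ((y.2 : ℕ) + 1)) := by
  rw [Fintype.sum_prod_type, Fintype.sum_prod_type]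
  refine Finset.sum_congr rfl fun t _ ↦ ?_
  rw [Fin.sum_univ_succ]
  simp only [Fin.val_zero, hP0, zero_mul, zero_add, Fin.val_succ]
  exact Finset.sum_congr rfl fun e _ ↦ cinf_term_rescale _ _ _ hm₀ _

/-- **A collected inequality, rescaled** (the `hrowe` / `himge` shape of `weilPositivityOn_of_cinf_poly` for the
rescaled families, from the `Fin 4 × Fin (D+1)` family form of the collected rows / images). -/
theorem cinf_collected_rescale {X ε ρ : ℝ} (P : Fin 4 → ℕ → ℝ) (hP0 : ∀ t, P t 0 = 0) (T : Fin 4 → ℝ) (m : ℝ)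
    {m₀ : ℝ} (hm₀ : m₀ ≠ 0) (D : ℕ)
    (h : |X - ε * ∑ x : Fin 4 × Fin (D + 1), P x.1 x.2 * (T x.1 / m ^ (x.2 : ℕ))| ≤ ρ) :
    |X - ε * ∑ y : Fin 4 × Fin D,
        P y.1 ((y.2 : ℕ) + 1) / m₀ ^ ((y.2 : ℕ) + 1) * (T y.1 * (m₀ / m) ^ ((y.2 : ℕ) + 1))| ≤ ρ := by
  rwa [cinf_sum_tagPow_rescale P hP0 T m hm₀ D] at h

/-- **A collected identity, rescaled** (the `hVe` shape, from `evenVTable_family` / `oddVTable_family`). -/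
theorem cinf_collected_rescale_eq {X ε : ℝ} (P : Fin 4 → ℕ → ℝ) (hP0 : ∀ t, P t 0 = 0) (T : Fin 4 → ℝ) (m : ℝ)
    {m₀ : ℝ} (hm₀ : m₀ ≠ 0) (D : ℕ)
    (h : X = ε * ∑ x : Fin 4 × Fin (D + 1), P x.1 x.2 * (T x.1 / m ^ (x.2 : ℕ))) :
    X = ε * ∑ y : Fin 4 × Fin D,
        P y.1 ((y.2 : ℕ) + 1) / m₀ ^ ((y.2 : ℕ) + 1) * (T y.1 * (m₀ / m) ^ ((y.2 : ℕ) + 1)) := by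
  rwa [cinf_sum_tagPow_rescale P hP0 T m hm₀ D] at h

/-! ## Square-summability of the rescaled families -/

/-- `(T·(m₀/(m₀+k))^n)² ≤ m₀²·(T²/(m₀+k)²)` for `1 ≤ n`, `1 ≤ m₀`. -/
theorem cinf_rescaled_sq_le {m₀ : ℕ} (hm₀ : 1 ≤ m₀) (T : ℝ) (k : ℕ) {n : ℕ} (hn : 1 ≤ n) :
    (T * ((m₀ : ℝ) / ((m₀ + k : ℕ) : ℝ)) ^ n) ^ 2 ≤ (m₀ : ℝ) ^ 2 * (T ^ 2 / ((m₀ + k : ℕ) : ℝ) ^ 2) := by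
  have hmk : 0 < m₀ + k := by omega
  have hpos : (0 : ℝ) < ((m₀ + k : ℕ) : ℝ) := by exact_mod_cast hmk
  have hr0 : 0 ≤ (m₀ : ℝ) / ((m₀ + k : ℕ) : ℝ) := by positivity
  have hr1 : (m₀ : ℝ) / ((m₀ + k : ℕ) : ℝ) ≤ 1 := by
    rw [div_le_one hpos]; exact_mod_cast Nat.le_add_right m₀ k
  have hpow : ((m₀ : ℝ) / ((m₀ + k : ℕ) : ℝ)) ^ n ≤ ((m₀ : ℝ) / ((m₀ + k : ℕ) : ℝ)) ^ 1 :=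
    pow_le_pow_of_le_one hr0 hr1 hn
  rw [pow_one] at hpow
  calc (T * ((m₀ : ℝ) / ((m₀ + k : ℕ) : ℝ)) ^ n) ^ 2
        = T ^ 2 * (((m₀ : ℝ) / ((m₀ + k : ℕ) : ℝ)) ^ n) ^ 2 := by ring
    _ ≤ T ^ 2 * ((m₀ : ℝ) / ((m₀ + k : ℕ) : ℝ)) ^ 2 :=
        mul_le_mul_of_nonneg_left (pow_le_pow_left₀ (pow_nonneg hr0 n) hpow 2) (sq_nonneg T)
    _ = (m₀ : ℝ) ^ 2 * (T ^ 2 / ((m₀ + k : ℕ) : ℝ) ^ 2) := by rw [div_pow]; ring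

/-- **Square-summability of a rescaled family** `T(m)·(m₀/m)^n`, `n ≥ 1`, from `Σ_k T(m₀+k)²/(m₀+k)² < ∞`. -/
theorem cinf_summable_rescaled_sq {m₀ : ℕ} (hm₀ : 1 ≤ m₀) {T : ℕ → ℝ}
    (hT : Summable fun k : ℕ ↦ T (m₀ + k) ^ 2 / ((m₀ + k : ℕ) : ℝ) ^ 2) {n : ℕ} (hn : 1 ≤ n) :
    Summable fun k : ℕ ↦ (T (m₀ + k) * ((m₀ : ℝ) / ((m₀ + k : ℕ) : ℝ)) ^ n) ^ 2 :=
  Summable.of_nonneg_of_le (fun _ ↦ sq_nonneg _) (fun k ↦ cinf_rescaled_sq_le hm₀ _ k hn) (hT.mul_left _)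

/-- **Bounded tags** (`1`, `−C_m`, `S_m`): `|T(m)| ≤ A` for all `m` gives `Σ_k T(m₀+k)²/(m₀+k)² < ∞`. -/
theorem cinf_summable_tag_sq_of_abs_le {T : ℕ → ℝ} {A : ℝ} (hA : ∀ m, |T m| ≤ A) (m₀ : ℕ) :
    Summable fun k : ℕ ↦ T (m₀ + k) ^ 2 / ((m₀ + k : ℕ) : ℝ) ^ 2 := by
  have hg : Summable fun n : ℕ ↦ T n ^ 2 / (n : ℝ) ^ 2 := by
    have h2 : Summable fun n : ℕ ↦ A ^ 2 * (1 / (n : ℝ) ^ 2) :=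
      (Real.summable_one_div_nat_pow.mpr (by norm_num)).mul_left _
    refine Summable.of_nonneg_of_le (fun n ↦ by positivity) (fun n ↦ ?_) h2
    rw [← mul_one_div (T n ^ 2)]
    refine mul_le_mul_of_nonneg_right ?_ (by positivity)
    have h := hA n
    have hA0 : 0 ≤ A := (abs_nonneg _).trans h
    calc T n ^ 2 = |T n| ^ 2 := (sq_abs _).symm
      _ ≤ A ^ 2 := pow_le_pow_left₀ (abs_nonneg _) h 2
  exact hg.comp_injective (add_right_injective m₀)

/-- **The `log` tag**: `Σ_k log(m₀+k)²/(m₀+k)² < ∞` (`4 ≤ m₀`; `WeilFormatCLogTailSums.summable_logSq_div_add_pow`). -/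
theorem cinf_summable_log_sq {m₀ : ℕ} (hm₀ : 4 ≤ m₀) :
    Summable fun k : ℕ ↦ Real.log (((m₀ + k : ℕ)) : ℝ) ^ 2 / ((m₀ + k : ℕ) : ℝ) ^ 2 := by
  have h := (summable_logSq_div_add_pow (k := 1) le_rfl hm₀).1
  convert h using 2 with j
  push_cast
  ring

/-! ## The Hankel family-Gram majorant -/

/-- **`hΓe` from Hankel entry boxes.**  Let `T : Fin 4 → ℕ → ℝ` be the tags, `1 ≤ m₀`, every `Σ_k T_t(m₀+k)²/(m₀+k)²`
summable, and suppose boxes for the RESCALED tail sums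
`|Σ'_k T_t(m₀+k) T_{t'}(m₀+k) (m₀/(m₀+k))^s − Hmid t t' s| ≤ Hrad t t' s` for all tags and all `2 ≤ s ≤ 2D`, with `Hrad`
symmetric in the tags.  Then for every `N`, every positive weight `ν` and every `u : Fin 4 × Fin D → ℝ`,
`Σ_{m ∈ Ico m₀ N} (Σ_y u_y · T_{y.1}(m)(m₀/m)^{y.2+1})²
   ≤ Σ_{y,y'} u_y u_{y'} Hmid(y.1,y'.1,y.2+y'.2+2) + Σ_y u_y² Σ_{y'} Hrad(y.1,y'.1,y.2+y'.2+2)·ν_{y'}/ν_y`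
— the `hΓe` hypothesis of `weilPositivityOn_of_cinf_poly` for the rescaled families, with ONE box per `(t,t',s)`. -/
theorem cinf_sum_Ico_sq_le_of_hankel_boxes {D m₀ : ℕ} (hm₀ : 1 ≤ m₀) (T : Fin 4 → ℕ → ℝ)
    (hT : ∀ t, Summable fun k : ℕ ↦ T t (m₀ + k) ^ 2 / ((m₀ + k : ℕ) : ℝ) ^ 2)
    (Hmid Hrad : Fin 4 → Fin 4 → ℕ → ℝ)
    (hH : ∀ (t t' : Fin 4) (s : ℕ), 2 ≤ s → s ≤ 2 * D →
      |(∑' k : ℕ, T t (m₀ + k) * T t' (m₀ + k) * ((m₀ : ℝ) / ((m₀ + k : ℕ) : ℝ)) ^ s) - Hmid t t' s|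
        ≤ Hrad t t' s)
    (hsym : ∀ t t' s, Hrad t t' s = Hrad t' t s)
    (ν : Fin 4 × Fin D → ℝ) (hν : ∀ y, 0 < ν y) (N : ℕ) (u : Fin 4 × Fin D → ℝ) :
    ∑ m ∈ Finset.Ico m₀ N, (∑ y, u y * (T y.1 m * ((m₀ : ℝ) / (m : ℝ)) ^ ((y.2 : ℕ) + 1))) ^ 2
      ≤ (∑ y, ∑ y', u y * u y' * Hmid y.1 y'.1 ((y.2 : ℕ) + (y'.2 : ℕ) + 2))
        + ∑ y, u y ^ 2 * ∑ y', Hrad y.1 y'.1 ((y.2 : ℕ) + (y'.2 : ℕ) + 2) * ν y' / ν y := by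
  classical
  -- the data of `sum_Ico_sq_sum_mul_le_of_boxes` over the product index
  have hφ : ∀ y : Fin 4 × Fin D,
      Summable fun k : ℕ ↦ (T y.1 (m₀ + k) * ((m₀ : ℝ) / ((m₀ + k : ℕ) : ℝ)) ^ ((y.2 : ℕ) + 1)) ^ 2 :=
    fun y ↦ cinf_summable_rescaled_sq hm₀ (hT y.1) (by omega)
  have hbox : ∀ y y' : Fin 4 × Fin D,
      |(∑' k : ℕ, (T y.1 (m₀ + k) * ((m₀ : ℝ) / ((m₀ + k : ℕ) : ℝ)) ^ ((y.2 : ℕ) + 1))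
          * (T y'.1 (m₀ + k) * ((m₀ : ℝ) / ((m₀ + k : ℕ) : ℝ)) ^ ((y'.2 : ℕ) + 1)))
        - Hmid y.1 y'.1 ((y.2 : ℕ) + (y'.2 : ℕ) + 2)| ≤ Hrad y.1 y'.1 ((y.2 : ℕ) + (y'.2 : ℕ) + 2) := by
    intro y y'
    have h2 := y.2.isLt
    have h2' := y'.2.isLt
    have h := hH y.1 y'.1 ((y.2 : ℕ) + (y'.2 : ℕ) + 2) (by omega) (by omega)
    have e : (fun k : ℕ ↦ (T y.1 (m₀ + k) * ((m₀ : ℝ) / ((m₀ + k : ℕ) : ℝ)) ^ ((y.2 : ℕ) + 1))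
          * (T y'.1 (m₀ + k) * ((m₀ : ℝ) / ((m₀ + k : ℕ) : ℝ)) ^ ((y'.2 : ℕ) + 1)))
        = fun k : ℕ ↦ T y.1 (m₀ + k) * T y'.1 (m₀ + k)
            * ((m₀ : ℝ) / ((m₀ + k : ℕ) : ℝ)) ^ ((y.2 : ℕ) + (y'.2 : ℕ) + 2) := by
      funext k; ring
    rw [e]; exact h
  have hρ : ∀ y y' : Fin 4 × Fin D,
      Hrad y.1 y'.1 ((y.2 : ℕ) + (y'.2 : ℕ) + 2) = Hrad y'.1 y.1 ((y'.2 : ℕ) + (y.2 : ℕ) + 2) := by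
    intro y y'; rw [hsym, Nat.add_comm (y.2 : ℕ)]
  -- transport `sum_Ico_sq_sum_mul_le_of_boxes` (index `Fin F`) along `Fintype.equivFin`
  set e := Fintype.equivFin (Fin 4 × Fin D) with he
  have hsum : ∀ g : Fin 4 × Fin D → ℝ,
      ∑ f : Fin (Fintype.card (Fin 4 × Fin D)), g (e.symm f) = ∑ x : Fin 4 × Fin D, g x :=
    fun g ↦ Equiv.sum_comp e.symm g
  have h := sum_Ico_sq_sum_mul_le_of_boxes
    (fun f m ↦ T (e.symm f).1 m * ((m₀ : ℝ) / (m : ℝ)) ^ (((e.symm f).2 : ℕ) + 1)) m₀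
    (fun f ↦ hφ (e.symm f))
    (fun f f' ↦ Hmid (e.symm f).1 (e.symm f').1 (((e.symm f).2 : ℕ) + ((e.symm f').2 : ℕ) + 2))
    (fun f f' ↦ Hrad (e.symm f).1 (e.symm f').1 (((e.symm f).2 : ℕ) + ((e.symm f').2 : ℕ) + 2))
    (fun f f' ↦ hbox (e.symm f) (e.symm f')) (fun f f' ↦ hρ (e.symm f) (e.symm f'))
    (fun f ↦ ν (e.symm f)) (fun f ↦ hν (e.symm f)) N (fun f ↦ u (e.symm f))
  have e1 : ∀ m : ℕ, ∑ f : Fin (Fintype.card (Fin 4 × Fin D)),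
      u (e.symm f) * (T (e.symm f).1 m * ((m₀ : ℝ) / (m : ℝ)) ^ (((e.symm f).2 : ℕ) + 1))
        = ∑ y : Fin 4 × Fin D, u y * (T y.1 m * ((m₀ : ℝ) / (m : ℝ)) ^ ((y.2 : ℕ) + 1)) :=
    fun m ↦ hsum (fun y ↦ u y * (T y.1 m * ((m₀ : ℝ) / (m : ℝ)) ^ ((y.2 : ℕ) + 1)))
  have e2 : ∑ f : Fin (Fintype.card (Fin 4 × Fin D)), ∑ f' : Fin (Fintype.card (Fin 4 × Fin D)),
      u (e.symm f) * u (e.symm f')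
        * Hmid (e.symm f).1 (e.symm f').1 (((e.symm f).2 : ℕ) + ((e.symm f').2 : ℕ) + 2)
      = ∑ y : Fin 4 × Fin D, ∑ y' : Fin 4 × Fin D, u y * u y' * Hmid y.1 y'.1 ((y.2 : ℕ) + (y'.2 : ℕ) + 2) := by
    rw [← hsum (fun y ↦ ∑ y' : Fin 4 × Fin D, u y * u y' * Hmid y.1 y'.1 ((y.2 : ℕ) + (y'.2 : ℕ) + 2))]
    exact Finset.sum_congr rfl fun f _ ↦
      hsum (fun y' ↦ u (e.symm f) * u y' * Hmid (e.symm f).1 y'.1 (((e.symm f).2 : ℕ) + (y'.2 : ℕ) + 2))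
  have e3 : ∑ f : Fin (Fintype.card (Fin 4 × Fin D)), u (e.symm f) ^ 2 *
      ∑ f' : Fin (Fintype.card (Fin 4 × Fin D)),
        Hrad (e.symm f).1 (e.symm f').1 (((e.symm f).2 : ℕ) + ((e.symm f').2 : ℕ) + 2)
          * ν (e.symm f') / ν (e.symm f)
      = ∑ y : Fin 4 × Fin D, u y ^ 2 *
          ∑ y' : Fin 4 × Fin D, Hrad y.1 y'.1 ((y.2 : ℕ) + (y'.2 : ℕ) + 2) * ν y' / ν y := by
    rw [← hsum (fun y ↦ u y ^ 2 *
      ∑ y' : Fin 4 × Fin D, Hrad y.1 y'.1 ((y.2 : ℕ) + (y'.2 : ℕ) + 2) * ν y' / ν y)]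
    exact Finset.sum_congr rfl fun f _ ↦ by
      rw [hsum (fun y' ↦ Hrad (e.symm f).1 y'.1 (((e.symm f).2 : ℕ) + (y'.2 : ℕ) + 2) * ν y' / ν (e.symm f))]
  simp only [e1] at h
  rw [e2, e3] at h
  exact h

/-! ## Feeding the boxes -/

/-- **A fixed-point box as a (mid, rad) pair**: `MI.mem S x B` gives `|x − (lo+hi)/(2S)| ≤ (hi−lo)/(2S)`. -/
theorem cinf_abs_sub_mid_le_of_mem {S : ℕ} (hS : 0 < S) {x : ℝ}
    {B : Literature.Analysis.ValidatedNumerics.NumericsMP.MI}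
    (h : Literature.Analysis.ValidatedNumerics.NumericsMP.MI.mem S x B) :
    |x - ((B.lo : ℝ) + B.hi) / (2 * S)| ≤ ((B.hi : ℝ) - B.lo) / (2 * S) := by
  have hS' : (0 : ℝ) < S := by exact_mod_cast hS
  have h1 : (B.lo : ℝ) ≤ x * S := h.1
  have h2 : x * S ≤ (B.hi : ℝ) := h.2
  have e : x - ((B.lo : ℝ) + B.hi) / (2 * S) = (2 * (x * S) - ((B.lo : ℝ) + B.hi)) / (2 * S) := by
    field_simp
  rw [e, abs_div, abs_of_pos (by positivity : (0 : ℝ) < 2 * S), div_le_div_iff_of_pos_right (by positivity),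
    abs_le]
  constructor <;> linarith

/-- **The pure×pure Hankel entry** in the form enclosed by `CinfCoeff.mem_pureTailScaledBox`:
`Σ'_k 1·1·(m₀/(m₀+k))^s = m₀^s·Σ'_k ((k + m₀)^s)⁻¹`. -/
theorem cinf_pure_hankel_entry_eq (m₀ s : ℕ) :
    (∑' k : ℕ, (1 : ℝ) * 1 * ((m₀ : ℝ) / ((m₀ + k : ℕ) : ℝ)) ^ s)
      = ((m₀ : ℚ) : ℝ) ^ s * ∑' k : ℕ, (((k : ℝ) + ((m₀ : ℚ) : ℝ)) ^ s)⁻¹ := by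
  rw [← tsum_mul_left]
  refine tsum_congr fun k ↦ ?_
  simp only [one_mul, Rat.cast_natCast, Nat.cast_add]
  rw [div_pow, div_eq_mul_inv, add_comm]

end Summit.RiemannHypothesis.RiemannHypothesis.Theorems.WeilFormatC
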